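import Mathlib
import Summits.Ventures.PercRepro2.Defs
import Summits.Ventures.PercRepro2.Harris
import Summits.Ventures.PercRepro2.Independence
import Summits.Ventures.PercRepro2.CoinDefs
import Summits.Ventures.PercRepro2.CoinReverse
import Summits.Ventures.PercRepro2.CoinStarDefs
import Summits.Ventures.PercRepro2.CoinLsmCoreDefs
import Summits.Ventures.PercRepro2.CoinLsmCoreU
import Summits.Ventures.PercRepro2.CoinCoreGate
import Summits.Ventures.PercRepro2.CoinOrTailKDefs

/-!
# The k-entry OR-tail: the tail-mixed values and the seven core sums (blind cell PercRepro2,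
night-2 g10; proofs/NIGHT2-DARC.md §41)

`rValK A pr ent c a W = tailWtK W · A W + (1 − tailWtK W) · A (W ∪ {a})` and `gValK` (with
`{a, w}`) are the head values averaged over the entry coins; `OrTailK.sum_R_eq` / `sum_G_eq`
turn the seven core sums of `ClosedInCoreU.phiC_gate_eq` over `U ∪ {a}` into sums over `U`
of `rValK` / `gValK` — the k-entry form of `OrTailU.sum_R_eq` / `sum_G_eq` (§37).
-/

namespace Summit.Ventures.PercRepro2.Coin

open Classical

section KVals

variable {V : Type*} {E : Type*} [DecidableEq V] {R : Type*} [CommRing R]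

/-- The `R`-value of the cluster `W`: the head value averaged over the entry coins. -/
def rValK (A : Finset V → R) (pr : E → R) (ent : Finset V) (c : V → E) (a : V)
    (W : Finset V) : R :=
  tailWtK pr ent c W * A W + (1 - tailWtK pr ent c W) * A (W ∪ {a})

/-- The gate value of the cluster `W`: as `rValK`, with `w` added whenever the tail is entered. -/
def gValK (A : Finset V → R) (pr : E → R) (ent : Finset V) (c : V → E) (a w : V)
    (W : Finset V) : R :=
  tailWtK pr ent c W * A W + (1 - tailWtK pr ent c W) * A (W ∪ {a, w})

/-- The tail weight does not see the tail vertex. -/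
lemma tailWtK_insert_a (pr : E → R) {ent : Finset V} (c : V → E) {a : V} (ha : a ∉ ent)
    (W : Finset V) : tailWtK pr ent c (insert a W) = tailWtK pr ent c W := by
  unfold tailWtK
  refine Finset.prod_congr rfl fun r hr => ?_
  have hra : r ≠ a := fun e => ha (e ▸ hr)
  simp only [Finset.mem_insert, hra, false_or]

end KVals

section KSums

variable {V : Type*} {E : Type*} [DecidableEq V] [Fintype E] [DecidableEq E]
  {R : Type*} [Field R]
  {arcs : E → Finset (V × V)} {s : V} {U : Finset V} {ent : Finset V} {c : V → E} {a w : V}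

/-- The `R`-side core sum over `U ∪ {a}` with a marker constant in `a` is the sum over `U` of
`rValK`. -/
lemma OrTailK.sum_R_eq (h : OrTailK arcs s U ent c a) (pr : E → R) (t : V)
    (m : Finset V → R) (hm : ∀ W, m (insert a W) = m W) :
    ∑ W ∈ (insert a U).powerset, prob pr (coreLevel arcs s (insert a U) W) *
        prob pr (coreAvoidEvent arcs s t (insert a U) W) * m W =
      ∑ W ∈ U.powerset, prob pr (coreLevel arcs s U W) *
          rValK (fun X => prob pr (coreAvoidEvent arcs s t (insert a U) X)) pr ent c a W *
            m W := by
  rw [Finset.sum_powerset_insert h.a_notin, ← Finset.sum_add_distrib]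
  refine Finset.sum_congr rfl fun W hW => ?_
  have hWU : W ⊆ U := Finset.mem_powerset.1 hW
  have haW : a ∉ W := fun haW => h.a_notin (hWU haW)
  have haE : a ∉ ent := fun he => h.a_notin (h.ent_sub he)
  have hins : insert a W = W ∪ {a} := by rw [Finset.insert_eq, Finset.union_comm]
  rw [h.prob_coreLevel_eq pr W, h.prob_coreLevel_eq pr (insert a W),
    h.prob_tailEventK pr W, h.prob_tailEventK pr (insert a W), hm W,
    Finset.insert_inter_of_notMem h.a_notin, Finset.inter_eq_left.2 hWU,
    tailWtK_insert_a pr c haE W]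
  simp only [rValK, haW, Finset.mem_insert_self, if_true, if_false]
  rw [hins]
  ring

/-- The gate-side core sum over `U ∪ {a}` with a marker constant in `a` is the sum over `U` of
`gValK`. -/
lemma OrTailK.sum_G_eq (h : OrTailK arcs s U ent c a) (pr : E → R) (t : V)
    (m : Finset V → R) (hm : ∀ W, m (insert a W) = m W) :
    ∑ W ∈ (insert a U).powerset, prob pr (coreLevel arcs s (insert a U) W) *
        prob pr (coreAvoidEvent arcs s t (insert a U) (starTarget a w W)) * m W =
      ∑ W ∈ U.powerset, prob pr (coreLevel arcs s U W) *
          gValK (fun X => prob pr (coreAvoidEvent arcs s t (insert a U) X)) pr ent c a w W *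
            m W := by
  rw [Finset.sum_powerset_insert h.a_notin, ← Finset.sum_add_distrib]
  refine Finset.sum_congr rfl fun W hW => ?_
  have hWU : W ⊆ U := Finset.mem_powerset.1 hW
  have haW : a ∉ W := fun haW => h.a_notin (hWU haW)
  have haE : a ∉ ent := fun he => h.a_notin (h.ent_sub he)
  have hsw : insert w (insert a W) = W ∪ {a, w} := by
    ext x
    simp only [Finset.mem_insert, Finset.mem_union, Finset.mem_singleton]
    tauto
  have hst1 : starTarget a w W = W := by simp [starTarget, haW]
  have hst2 : starTarget a w (insert a W) = W ∪ {a, w} := by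
    simp only [starTarget, Finset.mem_insert_self, if_true]
    exact hsw
  rw [h.prob_coreLevel_eq pr W, h.prob_coreLevel_eq pr (insert a W),
    h.prob_tailEventK pr W, h.prob_tailEventK pr (insert a W), hm W,
    Finset.insert_inter_of_notMem h.a_notin, Finset.inter_eq_left.2 hWU, hst1, hst2,
    tailWtK_insert_a pr c haE W]
  simp only [gValK, haW, Finset.mem_insert_self, if_true, if_false]
  ring

end KSums

end Summit.Ventures.PercRepro2.Coin
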